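import Mathlib
import Summits.CriticalPhenomena.SAWScalingLimit.Theses.SAWRenewalTightness
import Literature.Probability.RandomPlanarGeometry.SAWBridges

/-!
# Crux `AnnularMassDecay` (stmt-CriticalPhenomena-4729) — ideator 2 sketch (round 1)

First-lemma signatures for three crux idea cards (all `def … : Prop` over existing declarations;
nothing is proved here):

* card A `normal-kesten-closure-domination`: `hpBallMassDir`, `HalfPlaneBallDecay`, first lemma
    `AnnularOfHalfPlane : HalfPlaneBallDecay → AnnularMassDecay`; `DirKestenBound`,
    `RenewalWindowSparsity` (KW), `FlatHittingBound` (the θ = 0 content, implied), `PrefixFreeKestenBound`,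
    `EscapeWeightedBound`, `ClosureHittingDecay` (KH), `IrreducibleBridgeSpread` (TS), `UntrappedBulk` (UB),
    `CardAChain`;
* card B `antipodal-pinning-transience`: `sectorMass`, `axisBridgeMass`, `AntipodalPinning`,
    `AxisGreenSummable`, `SectorSquareSummable`, `Card3Chain`.

Conventions: walks are the function model `SAW.Zd.saws 2 n` (start `0`, frozen after `n`), shifted by
the start vertex `u`; `lev c s v = c v₀ + s v₁` is the level functional of the unit direction `(c,s)`;
`x_c = SAW.criticalFugacity`.
-/

noncomputable section

open scoped BigOperators Classical
open Finset Literature.Probability.LatticeModels Literature.Probability.RandomPlanarGeometry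

namespace Summit.CriticalPhenomena.SAWScalingLimit.Cruxes.AnnularMassDecay.Ideator2

/-- Shorthand: `x_c = 1/μ(ℤ²)`. -/
abbrev xc : ℝ := SAW.criticalFugacity

/-- Level functional of the direction `(c, s)` (meant with `c² + s² = 1`). -/
def lev (c s : ℝ) (v : Site 2) : ℝ := c * (v 0 : ℝ) + s * (v 1 : ℝ)

/-! ## Card A — Kesten in the inward normal direction: renewal window -/

/-- Half-plane-to-ball hitting mass (partial sum up to length `N`), direction `(c,s)`: `x_c`-mass of
SAWs from `u` whose vertices after the start lie strictly inside the open half-plane `{lev > lev u}`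
of inward normal `(c,s)`, avoid the closed ball `B̄(z,r)` at interior times and end in it (first
entry). No disc confinement. -/
def hpBallMassDir (c s : ℝ) (u : Site 2) (z : ℂ) (r : ℝ) (N : ℕ) : ℝ :=
  ∑ n ∈ range (N + 1), ∑ _ω ∈ (SAW.Zd.saws 2 n).filter (fun ω =>
      (∀ i, 0 < i → i ≤ n → 0 < lev c s (ω i)) ∧
      (∀ i, 0 < i → i < n → r < dist (Site.toComplex (u + ω i)) z) ∧
      dist (Site.toComplex (u + ω n)) z ≤ r), xc ^ n

/-- **(HP) Half-plane ball decay** — the transfer `C⁺` of card 1 (ALIGNED form: the half-plane is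
the supporting half-plane at `u` of the disc centred `z`, inward normal `e = (z-u)/|z-u|`, which may
be irrational): the hitting mass of `B̄(z,r)` is `≤ C (r/R)^θ` whenever `|u - z| ≥ R > r ≥ 1`. -/
def HalfPlaneBallDecay : Prop :=
  ∃ θ C : ℝ, 0 < θ ∧ ∀ (u : Site 2) (z : ℂ) (r R : ℝ), 1 ≤ r → r < R →
    R ≤ dist (Site.toComplex u) z → ∀ N : ℕ,
      hpBallMassDir ((z - Site.toComplex u).re / dist (Site.toComplex u) z)
        ((z - Site.toComplex u).im / dist (Site.toComplex u) z) u z r N ≤ C * (r / R) ^ θ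

/-- **First lemma of card 1 (provable now, pure geometry):** for `v ∈ B(z,R)` and `|u-z| ≥ R`,
`⟨v-u, e⟩ = ⟨v-z, e⟩ + |z-u| > -R + R ≥ 0`, so every annular bridge of the crux is an aligned
half-plane walk killed at the ball (and the disc confinement is dropped by monotonicity of
nonnegative sums): (HP) implies the crux with the same `θ, C`. -/
def AnnularOfHalfPlane : Prop :=
  HalfPlaneBallDecay → Theses.SAWRenewalTightness.AnnularMassDecay

/-- Directional bridge from `0` (Madras–Slade Def. 1.2.4 with the first coordinate replaced by
`lev c s`): `lev(ω 0) < lev(ω i) ≤ lev(ω n)` for `1 ≤ i ≤ n`. -/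
def IsDirBridge (c s : ℝ) (n : ℕ) (ω : ℕ → Site 2) : Prop :=
  ∀ i, 1 ≤ i → i ≤ n → lev c s (ω 0) < lev c s (ω i) ∧ lev c s (ω i) ≤ lev c s (ω n)

/-- Directional break point (Madras–Slade (4.2.1) with `lev`). -/
def IsDirBreak (c s : ℝ) (n : ℕ) (ω : ℕ → Site 2) (j : ℕ) : Prop :=
  0 < j ∧ j < n ∧ (∀ i ≤ j, lev c s (ω i) ≤ lev c s (ω j)) ∧
    ∀ i, j < i → i ≤ n → lev c s (ω j) < lev c s (ω i)

/-- `x_c`-mass of irreducible directional bridges of span `≥ t` (partial sums): the Kesten tail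
`P̄ᵉ(t)` of the span law of one irreducible `e`-bridge (`t = 0`: all of them, `Aᵉ(x_c)`). -/
def dirIrrMassGe (c s : ℝ) (t : ℝ) (N : ℕ) : ℝ :=
  ∑ n ∈ range (N + 1), ∑ _ω ∈ (SAW.Zd.saws 2 n).filter (fun ω =>
      1 ≤ n ∧ IsDirBridge c s n ω ∧ (∀ j, ¬ IsDirBreak c s n ω j) ∧ t ≤ lev c s (ω n)), xc ^ n

/-- **Direction-free Kesten bound** `Aᵉ(x_c) ≤ 1` for EVERY unit direction (no unfolding needed:
`Bᵉ(x) = 1/(1-Aᵉ(x)) < ∞` for `x < x_c` by `c_n^{1/n} → μ`, then monotone convergence).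
Provable now (M). -/
def DirKestenBound : Prop :=
  ∀ (c s : ℝ), c ^ 2 + s ^ 2 = 1 → ∀ N : ℕ, dirIrrMassGe c s 0 N ≤ 1

/-- Mass of directional bridges from `0` whose END is their first renewal level in `[a, b]`:
bridges with `a ≤ lev(end) ≤ b` and no break point at level `≥ a`. Its full sum is the Kesten
probability that the regenerative set of renewal LEVELS meets `[a,b]`. -/
def dirRenewalWindow (c s : ℝ) (a b : ℝ) (N : ℕ) : ℝ :=
  ∑ n ∈ range (N + 1), ∑ _ω ∈ (SAW.Zd.saws 2 n).filter (fun ω =>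
      1 ≤ n ∧ IsDirBridge c s n ω ∧ a ≤ lev c s (ω n) ∧ lev c s (ω n) ≤ b ∧
      ∀ j, IsDirBreak c s n ω j → lev c s (ω j) < a), xc ^ n

/-- **(KW) Renewal-window sparsity** (Kesten-side atom of card 1): a far window of relative length
`w/T` contains a renewal level with probability `≤ C (w/T)^θ`, uniformly in the direction
(predicted `θ = 1 - 3/4 = 1/4`; with `w = 1` it contains polynomial bridge decay `u_T ≤ C T^{-θ}`). -/
def RenewalWindowSparsity : Prop :=
  ∃ θ C : ℝ, 0 < θ ∧ ∀ (c s : ℝ), c ^ 2 + s ^ 2 = 1 → ∀ (w T : ℝ), 1 ≤ w → 2 * w ≤ T →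
    ∀ N : ℕ, dirRenewalWindow c s (T - w) T N ≤ C * (w / T) ^ θ

/-- **(P1) Flat hitting boundedness** (SAW-side atom of card 1, decay-free, winding included): the
half-plane-to-ball hitting mass is bounded as soon as the ball is at distance `≥ 2r`. -/
def FlatHittingBound : Prop :=
  ∃ C : ℝ, ∀ (c s : ℝ), c ^ 2 + s ^ 2 = 1 → ∀ (u : Site 2) (z : ℂ) (r : ℝ), 1 ≤ r →
    2 * r ≤ dist (Site.toComplex u) z → ∀ N : ℕ, hpBallMassDir c s u z r N ≤ C

/-! ## Card A, second half — record-closure (Doob) domination -/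

/-- A finite family of directional bridges from `0` (pairs length/function) is prefix-free. -/
def PrefixFree (c s : ℝ) (F : Finset (Σ n : ℕ, (ℕ → Site 2))) : Prop :=
  (∀ p ∈ F, p.2 ∈ SAW.Zd.saws 2 p.1 ∧ 1 ≤ p.1 ∧ IsDirBridge c s p.1 p.2) ∧
  ∀ p ∈ F, ∀ q ∈ F, p.1 < q.1 → ∃ i ≤ p.1, p.2 i ≠ q.2 i

/-- **Prefix-free Kesten bound** (first lemma of card 2; provable now from `DirKestenBound` by the
Kraft inequality for prefix codes over the irreducible-bridge alphabet + unique decoding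
`SAW.eq_of_append_eq`): `Σ_{B ∈ F} x_c^{|B|} ≤ 1`. -/
def PrefixFreeKestenBound : Prop :=
  ∀ (c s : ℝ), c ^ 2 + s ^ 2 = 1 → ∀ F : Finset (Σ n : ℕ, (ℕ → Site 2)), PrefixFree c s F →
    ∑ p ∈ F, xc ^ p.1 ≤ 1

/-- Record-closure (escape) mass of a killed prefix `π` of length `m` from `0`: extensions by `k ≤ K`
further SAW steps after which the whole walk is a directional bridge whose END is its first visit
above the previous record level `sup_{i ≤ m} lev(π i)`. -/
def escMass (c s : ℝ) (m : ℕ) (π : ℕ → Site 2) (K : ℕ) : ℝ :=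
  ∑ k ∈ range (K + 1), ∑ _ω ∈ (SAW.Zd.saws 2 (m + k)).filter (fun ω =>
      (∀ i ≤ m, ω i = π i) ∧ IsDirBridge c s (m + k) ω ∧
      (∀ i < m + k, lev c s (ω i) ≤ ⨆ j : Fin (m + 1), lev c s (π j)) ∧
      (⨆ j : Fin (m + 1), lev c s (π j)) < lev c s (ω (m + k))), xc ^ k

/-- **Escape-weighted domination** (card 2, provable now from `PrefixFreeKestenBound`): the
first-entry prefixes of the ball, each weighted by its record-closure mass, have total `x_c`-mass
`≤ 1` — the mass form of `Σ_π x_c^{|π|} Φ(π) = P(Γ enters the ball) ≤ 1`. -/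
def EscapeWeightedBound : Prop :=
  ∀ (c s : ℝ), c ^ 2 + s ^ 2 = 1 → ∀ (z : ℂ) (r : ℝ) (N K : ℕ),
    (∑ n ∈ range (N + 1), ∑ ω ∈ (SAW.Zd.saws 2 n).filter (fun ω =>
      (∀ i, 0 < i → i ≤ n → 0 < lev c s (ω i)) ∧
      (∀ i, 0 < i → i < n → r < dist (Site.toComplex (ω i)) z) ∧
      dist (Site.toComplex (ω n)) z ≤ r), xc ^ n * escMass c s n ω K) ≤ 1

/-- **(D-hit) Closure-weighted hitting decay** (Kesten-side atom of card 2, mass form of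
"the Kesten walk enters a far `r`-ball with probability `≤ C (r/R)^θ`"). -/
def ClosureHittingDecay : Prop :=
  ∃ θ C : ℝ, 0 < θ ∧ ∀ (c s : ℝ), c ^ 2 + s ^ 2 = 1 → ∀ (z : ℂ) (r R : ℝ), 1 ≤ r → r < R →
    R ≤ c * z.re + s * z.im → ∀ N K : ℕ,
    (∑ n ∈ range (N + 1), ∑ ω ∈ (SAW.Zd.saws 2 n).filter (fun ω =>
      (∀ i, 0 < i → i ≤ n → 0 < lev c s (ω i)) ∧
      (∀ i, 0 < i → i < n → r < dist (Site.toComplex (ω i)) z) ∧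
      dist (Site.toComplex (ω n)) z ≤ r), xc ^ n * escMass c s n ω K) ≤ C * (r / R) ^ θ

/-- **(TS) Transversal spread of one irreducible bridge** (the single genuinely two-dimensional atom
of card A): among irreducible `(c,s)`-bridges from `0` whose span reaches the near level `ℓ - r` of a
ball `B̄(z,r)` lying ahead at level `ℓ ≥ 2r` (any transversal offset), the `x_c`-mass of those whose
path visits the ball is `≤ C (r/ℓ)^θ ×` the Kesten tail `P̄ᵉ(ℓ - r)` (predicted `θ = 2 - 4/3 = 2/3`). -/
def IrreducibleBridgeSpread : Prop :=
  ∃ θ C : ℝ, 0 < θ ∧ ∀ (c s : ℝ), c ^ 2 + s ^ 2 = 1 → ∀ (z : ℂ) (r : ℝ), 1 ≤ r →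
    2 * r ≤ c * z.re + s * z.im → ∀ N : ℕ, ∃ N' : ℕ,
    (∑ n ∈ range (N + 1), ∑ _ω ∈ (SAW.Zd.saws 2 n).filter (fun ω =>
      1 ≤ n ∧ IsDirBridge c s n ω ∧ (∀ j, ¬ IsDirBreak c s n ω j) ∧
      c * z.re + s * z.im - r ≤ lev c s (ω n) ∧
      ∃ i ≤ n, dist (Site.toComplex (ω i)) z ≤ r), xc ^ n)
      ≤ C * (r / (c * z.re + s * z.im)) ^ θ * dirIrrMassGe c s (c * z.re + s * z.im - r) N'

/-- **(UB) Untrapped bulk** (relative, scale-free, decay-free atom of card A): a fixed fraction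
`δ` of the first-entry mass is carried by prefixes whose record-closure mass is at least `c₀`. -/
def UntrappedBulk : Prop :=
  ∃ c₀ δ : ℝ, 0 < c₀ ∧ 0 < δ ∧ ∀ (c s : ℝ), c ^ 2 + s ^ 2 = 1 → ∀ (z : ℂ) (r : ℝ), 1 ≤ r →
    r < ‖z‖ → ∀ N : ℕ, ∃ K : ℕ,
    (∑ n ∈ range (N + 1), ∑ _ω ∈ (SAW.Zd.saws 2 n).filter (fun ω =>
      (∀ i, 0 < i → i ≤ n → 0 < lev c s (ω i)) ∧
      (∀ i, 0 < i → i < n → r < dist (Site.toComplex (ω i)) z) ∧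
      dist (Site.toComplex (ω n)) z ≤ r ∧ escMass c s n ω K < c₀), xc ^ n)
      ≤ (1 - δ) * hpBallMassDir c s 0 z r N

/-- The two compositions card A asks crux-plan to kernel-check (bookkeeping, M-sized each):
renewal decomposition + Kraft give the Kesten hitting bound; domination gives (HP). -/
def CardAChain : Prop :=
  (DirKestenBound → RenewalWindowSparsity → IrreducibleBridgeSpread → ClosureHittingDecay) ∧
  (UntrappedBulk → ClosureHittingDecay → HalfPlaneBallDecay)

/-! ## Card B — antipodal pinning and transverse transience -/

/-- Sector-confined annular crossing mass: walks from `u₁ = (-R, 0)` whose interior vertices lie in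
the open west quarter-sector `{|y| < -x}` of the annulus `1 < |v| < R` and which end at first entry
of the closed unit ball (necessarily at `(-1,0)`). -/
def sectorMass (R : ℕ) (N : ℕ) : ℝ :=
  ∑ n ∈ range (N + 1), ∑ _ω ∈ (SAW.Zd.saws 2 n).filter (fun ω =>
      (∀ i, 0 < i → i < n →
        1 < dist (Site.toComplex (![-(R : ℤ), 0] + ω i)) 0 ∧
        dist (Site.toComplex (![-(R : ℤ), 0] + ω i)) 0 < R ∧
        |((![-(R : ℤ), 0] + ω i) 1 : ℝ)| < -((![-(R : ℤ), 0] + ω i) 0 : ℝ)) ∧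
      dist (Site.toComplex (![-(R : ℤ), 0] + ω n)) 0 ≤ 1), xc ^ n

/-- Renewal Green function on the axis: `x_c`-mass of bridges from `0` ending exactly at `(x, 0)`
(`= P(Γ has a renewal point at (x,0))`, Madras–Slade (8.1.18)). -/
def axisBridgeMass (x : ℤ) (N : ℕ) : ℝ :=
  ∑ n ∈ range (N + 1),
    ∑ _ω ∈ (SAW.Zd.sawFun 2 n ![x, 0]).filter (fun ω => SAW.Zd.IsBridge n ω), xc ^ n

/-- **Antipodal pinning** (first lemma of card 3, provable now): glue a west-sector crossing, the two
steps through the virgin centre, and a reversed east-sector crossing into ONE bridge of span `2R`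
pinned at both ends: `S(R)² x_c² ≤ G^K((-R,0),(R,0)) (≤ u_{2R} ≤ 1)`. -/
def AntipodalPinning : Prop :=
  ∀ R N : ℕ, 2 ≤ R → sectorMass R N ^ 2 * xc ^ 2 ≤ axisBridgeMass (2 * R) (2 * N + 2)

/-- **Transverse transience** in mass form (shared atom with crux stmt-7117's card
`kesten-product-renewal-dictionary`): the expected number of renewal points of the Kesten walk on
its own axis is finite. -/
def AxisGreenSummable : Prop :=
  ∃ C : ℝ, ∀ K N : ℕ, ∑ x ∈ range (K + 1), axisBridgeMass x N ≤ C

/-- Consequence targeted by card 3: square-summability over ALL scales of the sector-confined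
crossing masses (hence `S(R) → 0`, and `S(R) ≲ R^{-1/2}` along a density-one set of scales). -/
def SectorSquareSummable : Prop :=
  ∃ C : ℝ, ∀ K N : ℕ, ∑ R ∈ range (K + 1), sectorMass R N ^ 2 ≤ C

/-- The composition card 3 asks a prover to check first (pure algebra over the two defs above). -/
def Card3Chain : Prop := AntipodalPinning → AxisGreenSummable → SectorSquareSummable

end Summit.CriticalPhenomena.SAWScalingLimit.Cruxes.AnnularMassDecay.Ideator2
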